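import Mathlib
import Literature.GroupTheory.SpecificGroups.AlternatingSixPSL2Nine
import HarnessLib

/-!
# The heart of `𝔽₃[six points]` and the twisted tensor square of `SL₂(𝔽₉)`, I: matrix algebra

Prelude to `Summits/Langlands/Langlands/Theorems/TrigonalHeartLimitHeartTwistedTensor.lean`, which
proves the route item `Summit.Langlands.Langlands.Theses.TrigonalHeartLimit.HeartTwistedTensor`
(`stmt-Langlands-12741`): under an isomorphism `A₆ ≅ PSL₂(𝔽₉)` the heart of the mod-`3` permutation
module of six points, restricted along `SL₂(𝔽₉) → PSL₂(𝔽₉) ≅ A₆ ≤ S₆`, is the twisted tensor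
product `W ⊗ W^{(3)}` of the standard representation (`W^{(3)}` its Frobenius twist).

This file is pure matrix algebra over Wilson's computable model `𝔽₉ = 𝔽₃[i]`
(`Literature.GroupTheory.SpecificGroups.AltSixPSL.F9`):

* `heartMat R σ`, the `4 × 4` matrix of `σ ∈ S₆` on the heart, written entry for entry as in the
  route statement, factors as `rowA · permMat σ · colB` (`heartMat_eq`) and is multiplicative in
  characteristic `3` (`heartMat_mul`; the `6 × 6` identity `colB · rowA = 1 + N₁ + N₂` with
  `rowA · N₁ = 0 = N₂ · colB` is where `𝟙 ∈ (sum-zero vectors)` i.e. `6 = 0` enters);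
* `tw g = e (g ⊗ ḡ) e⁻¹`, the twisted tensor square re-indexed by `(a, b) ↦ 2a + b`, is
  multiplicative (`tw_mul`, Mathlib `Matrix.mul_kronecker_mul`);
* `SL₂(𝔽₉)` is generated by `u = (1 1; 0 1)`, `v = (1 i; 0 1)`, `w = (0 1; -1 0)` (`mem_closure_uvw`):
  Mathlib's `Matrix.diagonal_transvection_induction` reduces this to finitely many word identities
  for transvections and diagonal matrices, checked by `decide`.

## References

* R. A. Wilson, *The Finite Simple Groups*, GTM 251, Springer 2009, §3.3.5. [Wilson2009]
* route file `Summits/Langlands/Langlands/Theses/TrigonalHeartLimit.lean`, item `HeartTwistedTensor`.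
-/

set_option linter.dupNamespace false

open scoped MatrixGroups Kronecker

namespace Summit.Langlands.Langlands.Theorems.TrigonalHeartLimitHeartTwistedTensor

open Literature.GroupTheory.SpecificGroups Literature.GroupTheory.SpecificGroups.AltSixPSL

/-! ### The heart matrix of a permutation of six letters -/

/-- The `4 × 4` matrix of `σ ∈ S₆` on the heart `S/⟨𝟙⟩` of `R[six points]` in characteristic `3`
(`S` = sum-zero vectors ∋ `𝟙`): basis `e_j - e_5` (`j < 4`), coordinates `e_i^* - e_4^*` (`i < 4`);
written exactly as in the route statement `HeartTwistedTensor`. [this route] -/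
def heartMat (R : Type*) [Ring R] (σ : Equiv.Perm (Fin 6)) : Matrix (Fin 4) (Fin 4) R :=
  Matrix.of fun i j : Fin 4 =>
    ((if ((σ (Fin.castAdd 2 j) : Fin 6) : ℕ) = (i : ℕ) then 1
        else if ((σ (Fin.castAdd 2 j) : Fin 6) : ℕ) = 4 then -1 else 0) -
      (if ((σ (Fin.last 5) : Fin 6) : ℕ) = (i : ℕ) then 1
        else if ((σ (Fin.last 5) : Fin 6) : ℕ) = 4 then -1 else 0) : R)

/-- The coordinate functionals `e_i^* - e_4^*` (`i < 4`), a `4 × 6` matrix. [folklore] -/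
def rowA (R : Type*) [Ring R] : Matrix (Fin 4) (Fin 6) R :=
  Matrix.of fun i k => (if (k : ℕ) = (i : ℕ) then 1 else 0) - (if (k : ℕ) = 4 then 1 else 0)

/-- The heart basis vectors `e_j - e_5` (`j < 4`), a `6 × 4` matrix. [folklore] -/
def colB (R : Type*) [Ring R] : Matrix (Fin 6) (Fin 4) R :=
  Matrix.of fun k j => (if k = Fin.castAdd 2 j then 1 else 0) - (if k = Fin.last 5 then 1 else 0)

/-- The permutation matrix of `σ` (column `k` is `e_{σ k}`). [folklore] -/
def permMat (R : Type*) [Ring R] (σ : Equiv.Perm (Fin 6)) : Matrix (Fin 6) (Fin 6) R :=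
  Matrix.of fun i k => if σ k = i then 1 else 0

/-- `(rowA · permMat σ) i l = rowA i (σ l)`. [folklore] -/
theorem rowA_mul_permMat_apply (R : Type*) [Ring R] (σ : Equiv.Perm (Fin 6)) (i : Fin 4)
    (l : Fin 6) : (rowA R * permMat R σ) i l = rowA R i (σ l) := by
  simp only [Matrix.mul_apply, permMat, Matrix.of_apply, mul_ite, mul_one, mul_zero,
    Finset.sum_ite_eq, Finset.mem_univ, if_true]

/-- The heart matrix factors as `rowA · permMat σ · colB`. [folklore] -/
theorem heartMat_eq (R : Type*) [Ring R] (σ : Equiv.Perm (Fin 6)) :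
    heartMat R σ = rowA R * permMat R σ * colB R := by
  ext i j
  have hi := i.isLt
  have key : ∀ x : Fin 6,
      (if (x : ℕ) = (i : ℕ) then (1 : R) else if (x : ℕ) = 4 then -1 else 0) = rowA R i x := by
    intro x
    simp only [rowA, Matrix.of_apply]
    split_ifs with h1 h2 <;> first | (exfalso; omega) | simp
  rw [Matrix.mul_apply]
  simp only [rowA_mul_permMat_apply, colB, Matrix.of_apply, mul_sub, mul_ite, mul_one, mul_zero,
    Finset.sum_sub_distrib, Finset.sum_ite_eq', Finset.mem_univ, if_true]
  simp only [heartMat, Matrix.of_apply, key]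

/-- Permutation matrices are multiplicative. [folklore] -/
theorem permMat_mul (R : Type*) [Ring R] (σ τ : Equiv.Perm (Fin 6)) :
    permMat R (σ * τ) = permMat R σ * permMat R τ := by
  ext i k
  simp only [Matrix.mul_apply, permMat, Matrix.of_apply, mul_ite, mul_one, mul_zero,
    Finset.sum_ite_eq, Finset.mem_univ, if_true, Equiv.Perm.mul_apply]
  split_ifs <;> rfl

/-- The correction term `N₁ = -(𝟙 ⊗ e_4^*)`. [folklore] -/
def N₁ : Matrix (Fin 6) (Fin 6) F9 := Matrix.of fun _ l => if (l : ℕ) = 4 then -1 else 0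

/-- The correction term `N₂ = -(e_5 ⊗ 𝟙^*)`. [folklore] -/
def N₂ : Matrix (Fin 6) (Fin 6) F9 := Matrix.of fun k _ => if (k : ℕ) = 5 then -1 else 0

/-- `colB · rowA = 1 + N₁ + N₂` over `𝔽₉` (this uses `6 = 0`). [folklore] -/
theorem colB_mul_rowA : colB F9 * rowA F9 = 1 + N₁ + N₂ := by
  decide +kernel

/-- The coordinates `e_i^* - e_4^*` kill `𝟙`: `rowA · N₁ = 0`. [folklore] -/
theorem rowA_mul_N₁ : rowA F9 * N₁ = 0 := by
  decide +kernel

/-- The basis vectors `e_j - e_5` have sum zero: `N₂ · colB = 0`. [folklore] -/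
theorem N₂_mul_colB : N₂ * colB F9 = 0 := by
  decide +kernel

/-- Permutation matrices fix `𝟙`: `permMat σ · N₁ = N₁`. [folklore] -/
theorem permMat_mul_N₁ (σ : Equiv.Perm (Fin 6)) : permMat F9 σ * N₁ = N₁ := by
  ext i l
  simp only [Matrix.mul_apply, permMat, N₁, Matrix.of_apply, ite_mul, one_mul, zero_mul]
  simp_rw [Equiv.apply_eq_iff_eq_symm_apply σ]
  simp only [Finset.sum_ite_eq', Finset.mem_univ, if_true]

/-- `𝟙^*` is invariant: `N₂ · permMat τ = N₂`. [folklore] -/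
theorem N₂_mul_permMat (τ : Equiv.Perm (Fin 6)) : N₂ * permMat F9 τ = N₂ := by
  ext k l
  simp only [Matrix.mul_apply, permMat, N₂, Matrix.of_apply, mul_ite, mul_one, mul_zero,
    Finset.sum_ite_eq, Finset.mem_univ, if_true]

/-- **The heart is a representation in characteristic `3`**: `heartMat` is multiplicative over
`𝔽₉`. [folklore] -/
theorem heartMat_mul (σ τ : Equiv.Perm (Fin 6)) :
    heartMat F9 (σ * τ) = heartMat F9 σ * heartMat F9 τ := by
  rw [heartMat_eq, heartMat_eq, heartMat_eq, permMat_mul]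
  have h1 : rowA F9 * permMat F9 σ * colB F9 * (rowA F9 * permMat F9 τ * colB F9) =
      rowA F9 * permMat F9 σ * (colB F9 * rowA F9) * permMat F9 τ * colB F9 := by
    simp only [Matrix.mul_assoc]
  rw [h1, colB_mul_rowA, Matrix.mul_add, Matrix.mul_add, Matrix.mul_one, Matrix.add_mul,
    Matrix.add_mul, Matrix.add_mul, Matrix.add_mul, Matrix.mul_assoc (rowA F9) (permMat F9 σ) N₁,
    permMat_mul_N₁, rowA_mul_N₁, Matrix.zero_mul, Matrix.zero_mul, add_zero,
    Matrix.mul_assoc (rowA F9 * permMat F9 σ) N₂ (permMat F9 τ), N₂_mul_permMat,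
    Matrix.mul_assoc (rowA F9 * permMat F9 σ) N₂ (colB F9), N₂_mul_colB, Matrix.mul_zero, add_zero,
    Matrix.mul_assoc (rowA F9) (permMat F9 σ) (permMat F9 τ)]

/-- `heartMat 1 = 1`. [folklore] -/
theorem heartMat_one : heartMat F9 1 = 1 := by
  decide +kernel

/-! ### The twisted tensor square -/

/-- The index bijection `(a, b) ↦ 2a + b`. [folklore] -/
def eIdx : Fin 2 × Fin 2 ≃ Fin 4 := finProdFinEquiv

/-- The twisted tensor square `g ⊗ ḡ` (`ḡ` = entrywise Frobenius `x ↦ x³`), re-indexed to a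
`4 × 4` matrix along `eIdx`. [folklore] -/
def tw (g : Matrix (Fin 2) (Fin 2) F9) : Matrix (Fin 4) (Fin 4) F9 :=
  Matrix.reindex eIdx eIdx (Matrix.kronecker g (g.map star))

/-- The twisted tensor square is multiplicative. [folklore] -/
theorem tw_mul (g h : Matrix (Fin 2) (Fin 2) F9) : tw (g * h) = tw g * tw h := by
  unfold tw
  have hs : (g * h).map (star : F9 → F9) = g.map star * h.map star := by
    have : (star : F9 → F9) = ⇑(starRingEnd F9) := rfl
    rw [this]
    exact Matrix.map_mul
  rw [hs]
  simp only [Matrix.kronecker, Matrix.mul_kronecker_mul, Matrix.reindex_apply]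
  rw [Matrix.submatrix_mul_equiv]

/-- `tw 1 = 1`. [folklore] -/
theorem tw_one : tw 1 = 1 := by
  decide +kernel

/-! ### Generators of `SL₂(𝔽₉)` -/

/-- `u = (1 1; 0 1)`. [folklore] -/
def gU : SL(2, F9) := ⟨!![1, 1; 0, 1], by decide +kernel⟩

/-- `v = (1 i; 0 1)`. [folklore] -/
def gV : SL(2, F9) := ⟨!![1, el 0 1; 0, 1], by decide +kernel⟩

/-- `w = (0 1; -1 0)`. [folklore] -/
def gW : SL(2, F9) := ⟨!![0, 1; -1, 0], by decide +kernel⟩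

/-- Upper transvections are words `uᵐ vⁿ` (`𝔽₉ = 𝔽₃ ⊕ 𝔽₃ i`). [folklore] -/
theorem transvection01_eq : ∀ c : F9, ∃ m n : Fin 3, Matrix.transvection (0 : Fin 2) 1 c =
    ((gU ^ (m : ℕ) * gV ^ (n : ℕ) : SL(2, F9)) : Matrix (Fin 2) (Fin 2) F9) := by
  decide +kernel

/-- Lower transvections are conjugates of upper ones by `w` (`w⁻¹ = w³`). [folklore] -/
theorem transvection10_eq : ∀ c : F9, Matrix.transvection (1 : Fin 2) 0 c =
    (gW : Matrix (Fin 2) (Fin 2) F9) * Matrix.transvection 0 1 (-c) *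
      ((gW ^ 3 : SL(2, F9)) : Matrix (Fin 2) (Fin 2) F9) := by
  decide +kernel

/-- `diag(a, a⁻¹) = t₀₁(a) t₁₀(-a⁻¹) t₀₁(a) w⁻¹`. [folklore] -/
theorem diagonal_eq : ∀ a b : F9, a * b = 1 → Matrix.diagonal ![a, b] =
    Matrix.transvection (0 : Fin 2) 1 a * Matrix.transvection 1 0 (-b) *
      Matrix.transvection 0 1 a * ((gW ^ 3 : SL(2, F9)) : Matrix (Fin 2) (Fin 2) F9) := by
  decide +kernel

/-- The transvection `t₀₁(c)` as an element of `SL₂(𝔽₉)`. [folklore] -/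
def T01 (c : F9) : SL(2, F9) :=
  ⟨Matrix.transvection 0 1 c, Matrix.det_transvection_of_ne 0 1 (by decide) c⟩

/-- The transvection `t₁₀(c)` as an element of `SL₂(𝔽₉)`. [folklore] -/
def T10 (c : F9) : SL(2, F9) :=
  ⟨Matrix.transvection 1 0 c, Matrix.det_transvection_of_ne 1 0 (by decide) c⟩

/-- `t₀₁(c) ∈ ⟨u, v, w⟩`. [folklore] -/
theorem T01_mem (c : F9) : T01 c ∈ Subgroup.closure ({gU, gV, gW} : Set SL(2, F9)) := by
  obtain ⟨m, n, hmn⟩ := transvection01_eq c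
  have h : T01 c = gU ^ (m : ℕ) * gV ^ (n : ℕ) := Subtype.ext hmn
  rw [h]
  exact mul_mem (pow_mem (Subgroup.subset_closure (by simp)) _)
    (pow_mem (Subgroup.subset_closure (by simp)) _)

/-- `t₁₀(c) ∈ ⟨u, v, w⟩`. [folklore] -/
theorem T10_mem (c : F9) : T10 c ∈ Subgroup.closure ({gU, gV, gW} : Set SL(2, F9)) := by
  have h : T10 c = gW * T01 (-c) * gW ^ 3 := Subtype.ext (transvection10_eq c)
  rw [h]
  have hW : gW ∈ Subgroup.closure ({gU, gV, gW} : Set SL(2, F9)) :=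
    Subgroup.subset_closure (by simp)
  exact mul_mem (mul_mem hW (T01_mem _)) (pow_mem hW _)

/-- A matrix of determinant one as an element of `SL₂(𝔽₉)`. [folklore] -/
def mkSL (A : Matrix (Fin 2) (Fin 2) F9) (hA : A.det = 1) : SL(2, F9) := ⟨A, hA⟩

/-- **`SL₂(𝔽₉) = ⟨u, v, w⟩`**, by Mathlib's `diagonal_transvection_induction` and the word
identities above. [folklore] -/
theorem mem_closure_uvw (g : SL(2, F9)) :
    g ∈ Subgroup.closure ({gU, gV, gW} : Set SL(2, F9)) := by
  have hW : gW ∈ Subgroup.closure ({gU, gV, gW} : Set SL(2, F9)) :=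
    Subgroup.subset_closure (by simp)
  have main := Matrix.diagonal_transvection_induction
    (P := fun A => ∃ hA : A.det = 1,
      mkSL A hA ∈ Subgroup.closure ({gU, gV, gW} : Set SL(2, F9)))
    (g : Matrix (Fin 2) (Fin 2) F9) ?_ ?_ ?_
  · obtain ⟨_, hmem⟩ := main
    exact hmem
  · intro D hD
    have hdet : (Matrix.diagonal D).det = 1 := by rw [hD]; exact g.2
    have hD1 : D 0 * D 1 = 1 := by
      rw [Matrix.det_diagonal, Fin.prod_univ_two] at hdet
      exact hdet
    have hDv : D = ![D 0, D 1] := by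
      funext i; fin_cases i <;> rfl
    refine ⟨hdet, ?_⟩
    have h : mkSL (Matrix.diagonal D) hdet = T01 (D 0) * T10 (-(D 1)) * T01 (D 0) * gW ^ 3 :=
      Subtype.ext (show Matrix.diagonal D = _ by
        conv_lhs => rw [hDv]
        exact diagonal_eq (D 0) (D 1) hD1)
    rw [h]
    exact mul_mem (mul_mem (mul_mem (T01_mem _) (T10_mem _)) (T01_mem _)) (pow_mem hW _)
  · intro t
    obtain ⟨i, j, hij, c⟩ := t
    refine ⟨Matrix.TransvectionStruct.det _, ?_⟩
    fin_cases i <;> fin_cases j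
    · exact absurd rfl hij
    · exact T01_mem c
    · exact T10_mem c
    · exact absurd rfl hij
  · rintro A B ⟨hA, hA'⟩ ⟨hB, hB'⟩
    have hAB : (A * B).det = 1 := by rw [Matrix.det_mul, hA, hB, mul_one]
    refine ⟨hAB, ?_⟩
    have h : mkSL (A * B) hAB = mkSL A hA * mkSL B hB := Subtype.ext rfl
    rw [h]
    exact mul_mem hA' hB'

end Summit.Langlands.Langlands.Theorems.TrigonalHeartLimitHeartTwistedTensor
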